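import Summits.ValiantsHypothesis.ValiantsHypothesis.Theorems.FifoMatchingNNInVNPDefs

/-!
# Route FifoMatching — `NNInVNP` (stmt-ValiantsHypothesis-11618): the recogniser on Boolean points

`nnRecogniserVal E` (`α ω β` at a Boolean arc set `E`) is `1` at good arc sets and `0` elsewhere
(BCS 1997, proof of Prop. (21.15), (A)–(B)), hence Boolean sums against it are sums over nest-free
matchings (`sum_nnRecogniserVal_mul`, (D)); the cover product at the arc set of `M` is the matching
monomial (`prod_cover_arcSet`); costs and degrees of the elementary factors `1 - X_s`, `1 - X_s + X_s X_t`
in the cost model of `ArithCircuit.complexity` (inputs and constants free).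

Honest framing: bookkeeping towards the membership lemma `NN ∈ VNP`; nothing here bears on `VP ≠ VNP`.
-/

set_option linter.dupNamespace false -- single-conjunct summit: `ValiantsHypothesis.ValiantsHypothesis`

noncomputable section

open MvPolynomial

universe u

namespace Summit.ValiantsHypothesis.ValiantsHypothesis.Theorems.FifoMatching

open Literature.Computability.AlgebraicComplexity

/-! ### The recogniser `α ω β` on Boolean points -/

section Recogniser

variable {N : ℕ} {R : Type*} [CommRing R]

/-- BCS 1997, proof of Prop. (21.15), (A)–(B) at a good arc set: the recogniser takes the value `1`.
[cite: BurgisserClausenShokrollahi1997, Prop. (21.15)] -/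
theorem nnRecogniserVal_eq_one {E : Fin N × Fin N → Bool} (hE : E ∈ goodArcSets N) :
    nnRecogniserVal (R := R) E = 1 := by
  obtain ⟨hor, hconf, hcov⟩ := mem_goodArcSets.1 hE
  have hα : ∀ pq ∈ nnBadPairs N,
      (1 - (if E pq.1 then (1 : R) else 0) * (if E pq.2 then (1 : R) else 0)) = 1 := by
    intro pq hpq
    have h := hconf pq hpq
    by_cases h1 : E pq.1 = true
    · have h2 : E pq.2 = false := by
        rw [Bool.eq_false_iff]
        exact fun h2 => h ⟨h1, h2⟩
      simp [h2]
    · rw [Bool.not_eq_true] at h1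
      simp [h1]
  have hω : ∀ a ∈ Finset.univ.filter (fun a : Fin N × Fin N => ¬ a.1 < a.2),
      (1 - (if E a then (1 : R) else 0)) = 1 := by
    intro a ha
    rw [Finset.mem_filter] at ha
    have h : E a = false := by
      rw [Bool.eq_false_iff]
      exact fun h => ha.2 (hor a h)
    simp [h]
  have hβ : ∀ v : Fin N, (∑ a ∈ Finset.univ.filter (fun a : Fin N × Fin N => a.1 = v ∨ a.2 = v),
      (if E a then (1 : R) else 0)) = 1 := by
    intro v
    obtain ⟨a₀, ha₀, hav⟩ := hcov v
    rw [Finset.sum_eq_single_of_mem a₀ (Finset.mem_filter.2 ⟨Finset.mem_univ _, hav⟩)]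
    · simp [ha₀]
    · intro b hb hne
      rw [Finset.mem_filter] at hb
      have h : E b = false := by
        rw [Bool.eq_false_iff]
        exact fun h => hne (eq_of_mem_goodArcSets hE h ha₀ hb.2 hav)
      simp [h]
  rw [nnRecogniserVal, Finset.prod_eq_one hα, Finset.prod_eq_one hω,
    Finset.prod_eq_one (fun v _ => hβ v), one_mul, one_mul]

/-- BCS 1997, proof of Prop. (21.15), (A)–(B) away from good arc sets: the recogniser vanishes (a
non-oriented arc kills `ω`, a conflicting pair kills `α`, an uncovered vertex kills `β`).
[cite: BurgisserClausenShokrollahi1997, Prop. (21.15)] -/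
theorem nnRecogniserVal_eq_zero {E : Fin N × Fin N → Bool} (hE : E ∉ goodArcSets N) :
    nnRecogniserVal (R := R) E = 0 := by
  rw [mem_goodArcSets] at hE
  rw [nnRecogniserVal]
  by_cases hor : ∀ a, E a = true → a.1 < a.2
  · by_cases hconf : ∀ pq ∈ nnBadPairs N, ¬ (E pq.1 = true ∧ E pq.2 = true)
    · have hcov : ¬ ∀ v : Fin N, ∃ a, E a = true ∧ (a.1 = v ∨ a.2 = v) :=
        fun h => hE ⟨hor, hconf, h⟩
      obtain ⟨v, hv⟩ := not_forall.1 hcov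
      have h0 : (∑ a ∈ Finset.univ.filter (fun a : Fin N × Fin N => a.1 = v ∨ a.2 = v),
          (if E a then (1 : R) else 0)) = 0 := by
        refine Finset.sum_eq_zero fun a ha => ?_
        rw [Finset.mem_filter] at ha
        have h : E a = false := by
          rw [Bool.eq_false_iff]
          exact fun h => hv ⟨a, h, ha.2⟩
        simp [h]
      rw [Finset.prod_eq_zero (Finset.mem_univ v) h0, mul_zero]
    · obtain ⟨pq, hpq⟩ := not_forall.1 hconf
      obtain ⟨hpq, h12⟩ := Classical.not_imp.1 hpq
      rw [not_not] at h12
      have h0 : (1 - (if E pq.1 then (1 : R) else 0) * (if E pq.2 then (1 : R) else 0)) = 0 := by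
        simp [h12.1, h12.2]
      rw [Finset.prod_eq_zero hpq h0, zero_mul, zero_mul]
  · obtain ⟨a, ha⟩ := not_forall.1 hor
    obtain ⟨ha, hle⟩ := Classical.not_imp.1 ha
    have hmem : a ∈ Finset.univ.filter (fun a : Fin N × Fin N => ¬ a.1 < a.2) :=
      Finset.mem_filter.2 ⟨Finset.mem_univ _, hle⟩
    have h0 : (1 - (if E a then (1 : R) else 0)) = 0 := by simp [ha]
    rw [Finset.prod_eq_zero hmem h0, mul_zero, zero_mul]

/-- **Boolean sums against the recogniser are sums over nest-free matchings**
(BCS 1997, proof of Prop. (21.15), (A), (B), (D)): for any weight `G`,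
`∑_{E ∈ {0,1}^{[N]×[N]}} α(E) ω(E) β(E) G(E) = ∑_{M nest-free matching} G(arcSet M)`.
[cite: BurgisserClausenShokrollahi1997, Prop. (21.15)] -/
theorem sum_nnRecogniserVal_mul (G : (Fin N × Fin N → Bool) → R) :
    ∑ E : Fin N × Fin N → Bool, nnRecogniserVal E * G E = ∑ M ∈ nnMatchings N, G (arcSet M) := by
  classical
  have h : ∀ E : Fin N × Fin N → Bool,
      nnRecogniserVal E * G E = if E ∈ goodArcSets N then G E else 0 := by
    intro E
    split_ifs with hE
    · rw [nnRecogniserVal_eq_one hE, one_mul]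
    · rw [nnRecogniserVal_eq_zero hE, zero_mul]
  rw [Finset.sum_congr rfl fun E _ => h E, ← Finset.sum_filter]
  have hfi : (Finset.univ.filter fun E : Fin N × Fin N → Bool => E ∈ goodArcSets N) = goodArcSets N := by
    ext E
    simp
  rw [hfi]
  symm
  refine Finset.sum_nbij arcSet (fun M hM => arcSet_mem_goodArcSets hM) arcSet_injOn ?_ (fun M _ => rfl)
  intro E hE
  obtain ⟨M, hM, rfl⟩ := exists_arcSet_eq (Finset.mem_coe.1 hE)
  exact ⟨M, Finset.mem_coe.2 hM, rfl⟩

/-- The cover product at the arc set of `M` is the matching monomial `∏_{i < M i} X_{(i, M i)}`.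
[cite: BurgisserClausenShokrollahi1997, Prop. (21.15)] -/
theorem prod_cover_arcSet (M : Fin N → Fin N) :
    ∏ a : Fin N × Fin N, (1 - (if arcSet M a then (1 : MvPolynomial (Fin N × Fin N) R) else 0) +
        (if arcSet M a then (1 : MvPolynomial (Fin N × Fin N) R) else 0) * X a) =
      ∏ i : Fin N, (if i < M i then X (i, M i) else 1) := by
  have hfac : ∀ a : Fin N × Fin N,
      (1 - (if arcSet M a then (1 : MvPolynomial (Fin N × Fin N) R) else 0) +
        (if arcSet M a then (1 : MvPolynomial (Fin N × Fin N) R) else 0) * X a) =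
      if arcSet M a then X a else 1 := by
    intro a
    by_cases h : arcSet M a = true
    · simp [h]
    · rw [Bool.not_eq_true] at h
      simp [h]
  simp_rw [hfac]
  rw [Fintype.prod_prod_type]
  refine Finset.prod_congr rfl fun i _ => ?_
  rw [Finset.prod_eq_single (M i)]
  · by_cases h : i < M i
    · have ht : arcSet M (i, M i) = true := (arcSet_eq_true_iff M _).2 ⟨h, rfl⟩
      rw [if_pos ht, if_pos h]
    · have ht : ¬ arcSet M (i, M i) = true := fun ht => h ((arcSet_eq_true_iff M _).1 ht).1
      rw [if_neg ht, if_neg h]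
  · intro j _ hj
    have ht : ¬ arcSet M (i, j) = true := fun ht => hj ((arcSet_eq_true_iff M _).1 ht).2.symm
    rw [if_neg ht]
  · intro h
    exact absurd (Finset.mem_univ _) h

end Recogniser

/-! ### Cost and degree of the elementary factors -/

section Costs

variable {k : Type u} [CommRing k] {σ : Type*}

/-- `deg (1 - X_s) ≤ 1`. [folklore] -/
theorem totalDegree_one_sub_X_le (s : σ) : (1 - X s : MvPolynomial σ k).totalDegree ≤ 1 := by
  refine (totalDegree_sub _ _).trans (max_le ?_ (totalDegree_X_le_one _))
  rw [totalDegree_one]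
  exact Nat.zero_le _

/-- `L(1 - X_s) ≤ 2`: `1 - X_s = 1 + (-1) · X_s` (BCS 1997, Def. (21.3), Convention (21.5): inputs and
constants are free). [cite: BurgisserClausenShokrollahi1997, Def. (21.3)] -/
theorem complexity_one_sub_X_le (s : σ) : complexity (1 - X s : MvPolynomial σ k) ≤ 2 := by
  have he : (1 - X s : MvPolynomial σ k) = C 1 + C (-1) * X s := by
    rw [map_neg, map_one, neg_one_mul, sub_eq_add_neg]
  rw [he]
  have h1 := complexity_add_le_holds (C 1 : MvPolynomial σ k) (C (-1) * X s)
  have h2 := complexity_mul_le_holds (C (-1) : MvPolynomial σ k) (X s)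
  have h3 := complexity_C_holds (σ := σ) (1 : k)
  have h4 := complexity_C_holds (σ := σ) (-1 : k)
  have h5 := complexity_X_holds (k := k) s
  omega

/-- `deg (1 - X_s + X_s X_t) ≤ 2`. [folklore] -/
theorem totalDegree_coverFactor_le (s t : σ) :
    (1 - X s + X s * X t : MvPolynomial σ k).totalDegree ≤ 2 := by
  refine (totalDegree_add _ _).trans (max_le ((totalDegree_one_sub_X_le s).trans (by norm_num)) ?_)
  exact (totalDegree_mul _ _).trans (add_le_add (totalDegree_X_le_one _) (totalDegree_X_le_one _))

/-- `L(1 - X_s + X_s X_t) ≤ 4`. [cite: BurgisserClausenShokrollahi1997, Def. (21.3)] -/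
theorem complexity_coverFactor_le (s t : σ) :
    complexity (1 - X s + X s * X t : MvPolynomial σ k) ≤ 4 := by
  have h1 := complexity_add_le_holds (1 - X s : MvPolynomial σ k) (X s * X t)
  have h2 := complexity_mul_le_holds (X s : MvPolynomial σ k) (X t)
  have h3 := complexity_one_sub_X_le (k := k) s
  have h4 := complexity_X_holds (k := k) s
  have h5 := complexity_X_holds (k := k) t
  omega

end Costs

end Summit.ValiantsHypothesis.ValiantsHypothesis.Theorems.FifoMatching

end
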